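import Summits.Langlands.Langlands.Theses.ParityBlindBianchi
import Summits.Langlands.Langlands.Theorems.ParityBlindBianchiTwoAdicBianchiProModularityLevelStubUniformizer
import Summits.Langlands.Langlands.Theorems.ParityBlindBianchiTwoAdicBianchiProModularityLevelReduction
import Summits.Langlands.Langlands.Theorems.ParityBlindBianchiTwoAdicBianchiProModularityLevelStubCongrDictionary
import Literature.NumberTheory.Automorphic.RegularAlgebraicCuspidalHeckePoint
import Literature.NumberTheory.Automorphic.RegularAlgebraicCuspidalHeckePointAssembly
import HarnessLib

/-!
# Line `Sketch` (card `local-flatness-transplant`) for the crux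
# `TwoAdicBianchiProModularityLevel` (stmt-Langlands-15110) — lead skeleton v5 (lead c11; v4 of c1/c2 + ESH/FL composition)

Composition `TwoAdicBianchiProModularityLevel_of`: the crux follows from

* `stub_uniformizer` — every finite place has a uniformiser in its completion (LANDED, p96237);
* `stub_heckeData` — the Galois half: integral Hecke data `a_{v,1} = tr/det`, `a_{v,2} = 1/(q det)`
  Hansen-associated with `σ` at every good place (LANDED p98537 in `…Reduction.lean`, from the landed
  stubs `stub_normTraceDet` p96322, `stub_charpolyInv` p96257, `stub_residueCardNorm` p96340);
* `stub_classicalHeckePoint` — (A-raw) THE AUTOMORPHIC-TO-COHOMOLOGY TRANSPORT (theorem in print: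
  Eichler–Shimura–Harder for Bianchi groups + "cohomological eigenclasses of algebraic weight are
  continuous integral points of the completed-cohomology Hecke algebra", Scholze Ann. 182 §V.4 /
  Emerton): a regular algebraic cuspidal `π₀` of `GL₂(𝔸_K)` unramified off `S₀ ∋ 2` gives a tame
  level `U₀` hyperspecial off `S₀` and, for any uniformisers, an `𝒪_{ℚ̄₂}`-valued point `b` of
  `Spf 𝕋(U₀²)` of the `2`-power Bianchi tower (`IsHeckePoint`, all stages — `π₀` IS `2`-adically
  automorphic) with `ι(b_{v,1}) = q_v^{1/2} e₁(α_v)`, `ι(b_{v,2}) = e₂(α_v)` (Satake–Tamagawa).  It is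
  the case `p = 2` of the named fact `bianchi_regularAlgebraicCuspidal_isHeckePoint`, stated in the
  stub file in the crux's vocabulary (the tree's `bianchi_cuspidal_regularLAlgebraic_eigenclassExists`
  and `algebraicWeightEigenclass_continuousPoint` are phrased for the `GL_n`-specific
  `CompletedCohomologyHeckeAlgebraGLn` with `ℤ/p^s` coefficients; the comparison with the generic
  `bigHeckeAlgebra`/`IsHeckePoint` of `CompletedCohomology` over `𝒪_{ℚ̄₂}` — towers, Hecke elements
  for arbitrary uniformisers, coefficient change `ℤ/2^s → 𝒪/2^t` — is not in the tree);
* `stub_congrDictionary` — (A-glue) the rank-two dictionary between the crux's residual hypothesis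
  (`charpoly σ(Frob_v) ≡ arithFrobPolyOfSatake ι q_v 2 α_v`) and Hansen's normalisation of the
  Hecke data: `b ≡ a` modulo the maximal ideal of `𝒪_{ℚ̄₂}` (LANDED p104947);
* `stub_artinLift` — (B) THE OPEN CONTENT in the tree's own vocabulary, free of automorphic
  representations: if the residual eigensystem of the icosahedral finite-image `σ` OCCURS in
  `𝕋(U₀²)` (witnessed by any `𝒪`-point `b ≡ a (mod 𝔪)`), then `σ`'s own Hansen data `a` is a point
  of `Spf 𝕋(U²)` for some tame level `U` hyperspecial off `S₀` — big `R = 𝕋` for `GL₂/K` in defect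
  `l₀ = 1` at `p = 2` (Gee–Newton Conj. 60 / Prop. 62, Calegari–Geraghty, Hansen Conj. 1.2.3) read at
  the Artin point.  This is the statement a planner can file as the `@[conjecture]` layer-2 item of
  the route's TWO-LAYER PLAN ("BigRT2Bianchi → ArtinLiftIsHeckePoint"), with no deformation-ring
  definition request needed.  NOTE: its hypothesis (occurrence in the torsion sense, the
  Calegari–Geraghty/Gee–Newton formulation "𝔪 non-Eisenstein in the support of completed
  cohomology") is slightly WEAKER than the crux's (characteristic-`0` cohomological residual
  automorphy), so (B) is slightly stronger than the crux — and exactly as conjectural.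

The composition chooses `ϖ` by `stub_uniformizer`, reads unramifiedness and the Frobenius
polynomials off the residual-automorphy hypothesis, takes `a` and its association from
`stub_heckeData`, the classical point `(U₀, b)` from `stub_classicalHeckePoint`, its congruence to
`a` at an arithmetic Frobenius of every good place from `stub_congrDictionary`, and `U` with the Hecke
point of `a` from `stub_artinLift`.  (The former single stub `stub_core` = (A) + (B) glued; its
reduction `TwoAdicBianchiProModularityLevel_of_core` stays landed in `…Reduction.lean`.)
-/

noncomputable section

set_option linter.dupNamespace false -- `Summit.Langlands.Langlands` is the mandated namespace (D-0017)

open scoped NumberField MatrixGroups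
open Polynomial IsDedekindDomain Field
open Literature.NumberTheory.GaloisRepresentations Literature.NumberTheory.Automorphic

namespace Summit.Langlands.Langlands.Theorems.TwoAdicBianchiProModularityLevel

/-! ### Stubs -/

-- LANDED (wave 1): `stub_uniformizer` (p96237, imported above); `stub_normTraceDet` (p96322),
-- `stub_charpolyInv` (p96257), `stub_residueCardNorm` (p96340) feed `stub_heckeData` (Reduction file).

-- LANDED (lead c0): `stub_heckeData` (p98537, …Reduction.lean, imported above, together with the reduction
-- `TwoAdicBianchiProModularityLevel_of_core`).

-- CLOSED MODULO A NAMED FACT (lead c1): `stub_classicalHeckePoint_ofFact` (p107234, …StubClassicalHeckePoint.lean,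
-- imported in v4) proves `Literature.NumberTheory.Automorphic.bianchi_regularAlgebraicCuspidal_isHeckePoint → (this stub)`;
-- the Literature named fact itself landed as p106821 (RegularAlgebraicCuspidalHeckePoint.lean).  The unconditional
-- stub below stays registered and open until `bianchi_regularAlgebraicCuspidal_isHeckePoint_holds` (Eichler–Shimura–Harder
-- for Bianchi groups in Lean); see `TwoAdicBianchiProModularityLevel_of_fact` for the crux modulo {fact, stub_artinLift}.

/-- STUB (A-raw) `stub_classicalHeckePoint` — **a regular algebraic cuspidal `π₀` of `GL₂(𝔸_K)` IS a
point of the big Hecke algebra of the `2`-power Bianchi tower** (theorem in print: Eichler–Shimura–Harder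
transport of `π₀` into `H^q(X_{U₀}, V_λ)` + "cohomological eigenclasses of algebraic weight are continuous
integral points of the completed-cohomology Hecke algebra", Scholze Ann. 182 §V.4 / Emerton).  For `K`
imaginary quadratic, `ι : ℚ̄₂ ≃ ℂ`, `π₀` cuspidal regular algebraic, `S₀ ∋ 2` with `π₀` unramified at
every good place: there is a tame level `U₀` — open, inside `GL₂(𝒪̂_K)`, containing every integral `g`
trivial at the bad places — such that for all uniformisers `ϖ` there are `𝒪_{ℚ̄₂}`-valued Hecke data
`b` with `ι(b_{v,1}) = q_v^{1/2} e₁(α_v)`, `ι(b_{v,2}) = e₂(α_v)` for every Satake parameter `α_v` of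
`π₀` at every good `v` (the tree's `HasSatakeParamAt` normalisation) forming a continuous point of
`Spf 𝕋(U₀²)` (`IsHeckePoint`, all stages).  It is the case `p = 2` of the named fact
`bianchi_regularAlgebraicCuspidal_isHeckePoint` (stated in the stub file in the crux's vocabulary and
relocated to `Literature/NumberTheory/Automorphic/BianchiCuspidalEigenclass.lean`; companion of the
tree's `bianchi_cuspidal_regularLAlgebraic_eigenclassExists` + `algebraicWeightEigenclass_continuousPoint`,
which are phrased for `CompletedCohomologyHeckeAlgebraGLn` with `ℤ/p^s` coefficients — the comparison
with the generic `bigHeckeAlgebra` over `𝒪_{ℚ̄₂}` is not in the tree).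
[cite: Scholze2015, §V.4, Thm. V.4.1 and proof of Cor. V.4.2] [cite: Harder1987] [difficulty: L] -/
theorem stub_classicalHeckePoint : ∀ (K : Type) [Field K] [NumberField K], NumberField.IsTotallyComplex K →
    Module.finrank ℚ K = 2 →
    ∀ (ι : PadicAlgCl 2 ≃+* ℂ) (hcpt : isCompact_glFiniteIntegralLevel 2 K)
      (π₀ : CuspidalAutomorphicRepData 2 K hcpt), π₀.1.IsRegularAlgebraic →
    ∀ S₀ : Finset ℕ, 2 ∈ S₀ →
    (∀ v : HeightOneSpectrum (𝓞 K), (∀ ℓ ∈ S₀, ((ℓ : ℕ) : 𝓞 K) ∉ v.asIdeal) → π₀.1.IsUnramifiedAt v) →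
    ∃ U₀ : Subgroup (GL (Fin 2) (FiniteAdeleRing (𝓞 K) K)),
      IsOpen (U₀ : Set (GL (Fin 2) (FiniteAdeleRing (𝓞 K) K))) ∧
      U₀ ≤ glFiniteIntegralLevel 2 K ∧
      (∀ g ∈ glFiniteIntegralLevel 2 K,
        (∀ v : HeightOneSpectrum (𝓞 K), ¬ (∀ ℓ ∈ S₀, ((ℓ : ℕ) : 𝓞 K) ∉ v.asIdeal) →
          ∀ i j : Fin 2, ((g : Matrix (Fin 2) (Fin 2) (FiniteAdeleRing (𝓞 K) K)) i j) v =
            (1 : Matrix (Fin 2) (Fin 2) (v.adicCompletion K)) i j) → g ∈ U₀) ∧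
      ∀ (ϖ : ∀ v : HeightOneSpectrum (𝓞 K), (v.adicCompletion K)ˣ),
        (∀ v : HeightOneSpectrum (𝓞 K),
          Valued.v ((ϖ v : (v.adicCompletion K)ˣ) : v.adicCompletion K) = WithZero.exp (-1 : ℤ)) →
        ∃ b : {v : HeightOneSpectrum (𝓞 K) // ∀ ℓ ∈ S₀, ((ℓ : ℕ) : 𝓞 K) ∉ v.asIdeal} → ℕ →
            (PadicAlgCl.valued 2).v.valuationSubring,
          (∀ (v : HeightOneSpectrum (𝓞 K)) (hv : ∀ ℓ ∈ S₀, ((ℓ : ℕ) : 𝓞 K) ∉ v.asIdeal)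
              (α : Multiset ℂ), π₀.1.HasSatakeParamAt v α →
            ι ((b ⟨v, hv⟩ 1 : (PadicAlgCl.valued 2).v.valuationSubring) : PadicAlgCl 2) =
                (((Real.sqrt (v.residueCard : ℝ) : ℝ) : ℂ)) * α.esymm 1 ∧
            ι ((b ⟨v, hv⟩ 2 : (PadicAlgCl.valued 2).v.valuationSubring) : PadicAlgCl 2) =
                α.esymm 2) ∧
          IsHeckePoint
            (Matrix.GeneralLinearGroup.map (algebraMap K (FiniteAdeleRing (𝓞 K) K)) :
              GL (Fin 2) K →* GL (Fin 2) (FiniteAdeleRing (𝓞 K) K))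
            (LevelTower.ofSeq U₀ (fun r : ℕ =>
              (principalCongruenceLevel 2 K (Ideal.span {((2 : ℕ) : 𝓞 K)} ^ r)).map (GLn.sndHom 2 K)))
            ((2 : ℕ) : (PadicAlgCl.valued 2).v.valuationSubring)
            (fun j : {v : HeightOneSpectrum (𝓞 K) // ∀ ℓ ∈ S₀, ((ℓ : ℕ) : 𝓞 K) ∉ v.asIdeal} × Fin 2 =>
              GLn.sndHom 2 K (heckeDiagAt 2 K j.1.1 (ϖ j.1.1) (j.2.val + 1)))
            (fun j => b j.1 (j.2.val + 1)) := by
  sorry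

-- LANDED (wave c1-1): `stub_congrDictionary` (p104947, …StubCongrDictionary.lean, imported above):
-- the rank-two Satake ↔ Hansen congruence dictionary `b ≡ a (mod 𝔪)`.

/-- STUB (B) `stub_artinLift` — **residual occurrence implies occurrence of the icosahedral Artin
lift: big `R = 𝕋` for `GL₂/K` in defect `l₀ = 1` at `p = 2`, read at the Artin point** (THE OPEN
CONTENT of the crux, in the tree's vocabulary; card `local-flatness-transplant`: Gee–Newton Conj. 60
at `p = 2` by CEGGPS uniqueness in grade one, Prop. 62 `R_{S̄} ≅ 𝕋(U²)_𝔪`, the finite-image `σ`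
being an `𝒪`-point of `R_{S̄}`).  For `K` imaginary quadratic with `2` split, `σ : Γ_K → GL₂(ℚ̄₂)`
continuous with finite image, irreducible, projective image `A₅`, `S₀ ∋ 2`, uniformisers `ϖ`, and
`𝒪_{ℚ̄₂}`-valued Hecke data `a` Hansen-associated with `σ` at every good place (so `σ` is unramified
off `S₀` and `a_{v,1} = tr σ(Frob_v⁻¹)`, `q_v a_{v,2} = det σ(Frob_v⁻¹)`): IF the residual
eigensystem `a mod 𝔪` occurs in the completed cohomology of the `2`-power Bianchi tower at some tame
level `U₀` hyperspecial off `S₀` — witnessed by an `𝒪_{ℚ̄₂}`-valued point `b` of `Spf 𝕋(U₀²)`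
(`IsHeckePoint`) with `‖b − a‖ < 1` at every good place, whence a continuous `𝕋(U₀²) → 𝔽̄₂` with
`T_{v,i} ↦ ā_{v,i}`, i.e. `𝔪_σ̄ ∈ Supp 𝕋(U₀²)`, `𝔪_σ̄` non-Eisenstein — THEN there is a tame level
`U` (open, inside `GL₂(𝒪̂_K)`, containing every integral `g` trivial at the bad places; free over
`S₀`, in particular as deep as needed at the odd places of `S₀`) at which `a` itself is a continuous
point of `Spf 𝕋(U²)` (`IsHeckePoint`, torsion allowed).  Slightly stronger than the crux (torsion
residual occurrence allowed), equally conjectural; no instance of its hypotheses is constructible in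
the tree today. [cite: GeeNewton2020, §5.1, Def. 59, Conj. 60, Rem. 61, Prop. 62]
[cite: CalegariGeraghty2017, Thm. 1.1 and §1] [cite: HansenUniversalEigenvarieties2017, Conj. 1.2.3]
[difficulty: open-problem] -/
theorem stub_artinLift : ∀ (K : Type) [Field K] [NumberField K], NumberField.IsTotallyComplex K →
    Module.finrank ℚ K = 2 →
    (∃ v w : HeightOneSpectrum (𝓞 K), v ≠ w ∧ ((2 : ℕ) : 𝓞 K) ∈ v.asIdeal ∧
      ((2 : ℕ) : 𝓞 K) ∈ w.asIdeal) →
    ∀ (σ : FramedGaloisRep K (PadicAlgCl 2) 2),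
    Finite σ.toMonoidHom.range → σ.toGaloisRep.IsIrreducible →
    Nonempty ((Matrix.ProjGenLinGroup.mk.comp σ.toMonoidHom).range ≃* alternatingGroup (Fin 5)) →
    ∀ S₀ : Finset ℕ, 2 ∈ S₀ →
    ∀ (ϖ : ∀ v : HeightOneSpectrum (𝓞 K), (v.adicCompletion K)ˣ),
    (∀ v : HeightOneSpectrum (𝓞 K),
      Valued.v ((ϖ v : (v.adicCompletion K)ˣ) : v.adicCompletion K) = WithZero.exp (-1 : ℤ)) →
    ∀ (a : {v : HeightOneSpectrum (𝓞 K) // ∀ ℓ ∈ S₀, ((ℓ : ℕ) : 𝓞 K) ∉ v.asIdeal} → ℕ →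
      (PadicAlgCl.valued 2).v.valuationSubring),
    (∀ (v : HeightOneSpectrum (𝓞 K)) (hv : ∀ ℓ ∈ S₀, ((ℓ : ℕ) : 𝓞 K) ∉ v.asIdeal),
      σ.IsHeckeAssociatedAt v (fun i : ℕ => if i = 0 then (1 : PadicAlgCl 2) else
        ((a ⟨v, hv⟩ i : (PadicAlgCl.valued 2).v.valuationSubring) : PadicAlgCl 2))) →
    (∃ U₀ : Subgroup (GL (Fin 2) (FiniteAdeleRing (𝓞 K) K)),
      IsOpen (U₀ : Set (GL (Fin 2) (FiniteAdeleRing (𝓞 K) K))) ∧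
      U₀ ≤ glFiniteIntegralLevel 2 K ∧
      (∀ g ∈ glFiniteIntegralLevel 2 K,
        (∀ v : HeightOneSpectrum (𝓞 K), ¬ (∀ ℓ ∈ S₀, ((ℓ : ℕ) : 𝓞 K) ∉ v.asIdeal) →
          ∀ i j : Fin 2, ((g : Matrix (Fin 2) (Fin 2) (FiniteAdeleRing (𝓞 K) K)) i j) v =
            (1 : Matrix (Fin 2) (Fin 2) (v.adicCompletion K)) i j) → g ∈ U₀) ∧
      ∃ b : {v : HeightOneSpectrum (𝓞 K) // ∀ ℓ ∈ S₀, ((ℓ : ℕ) : 𝓞 K) ∉ v.asIdeal} → ℕ →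
          (PadicAlgCl.valued 2).v.valuationSubring,
        (∀ j : {v : HeightOneSpectrum (𝓞 K) // ∀ ℓ ∈ S₀, ((ℓ : ℕ) : 𝓞 K) ∉ v.asIdeal} × Fin 2,
          ‖((b j.1 (j.2.val + 1) : (PadicAlgCl.valued 2).v.valuationSubring) : PadicAlgCl 2) -
            ((a j.1 (j.2.val + 1) : (PadicAlgCl.valued 2).v.valuationSubring) : PadicAlgCl 2)‖ < 1) ∧
        IsHeckePoint
          (Matrix.GeneralLinearGroup.map (algebraMap K (FiniteAdeleRing (𝓞 K) K)) :
            GL (Fin 2) K →* GL (Fin 2) (FiniteAdeleRing (𝓞 K) K))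
          (LevelTower.ofSeq U₀ (fun r : ℕ =>
            (principalCongruenceLevel 2 K (Ideal.span {((2 : ℕ) : 𝓞 K)} ^ r)).map (GLn.sndHom 2 K)))
          ((2 : ℕ) : (PadicAlgCl.valued 2).v.valuationSubring)
          (fun j : {v : HeightOneSpectrum (𝓞 K) // ∀ ℓ ∈ S₀, ((ℓ : ℕ) : 𝓞 K) ∉ v.asIdeal} × Fin 2 =>
            GLn.sndHom 2 K (heckeDiagAt 2 K j.1.1 (ϖ j.1.1) (j.2.val + 1)))
          (fun j => b j.1 (j.2.val + 1))) →
    ∃ U : Subgroup (GL (Fin 2) (FiniteAdeleRing (𝓞 K) K)),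
      IsOpen (U : Set (GL (Fin 2) (FiniteAdeleRing (𝓞 K) K))) ∧
      U ≤ glFiniteIntegralLevel 2 K ∧
      (∀ g ∈ glFiniteIntegralLevel 2 K,
        (∀ v : HeightOneSpectrum (𝓞 K), ¬ (∀ ℓ ∈ S₀, ((ℓ : ℕ) : 𝓞 K) ∉ v.asIdeal) →
          ∀ i j : Fin 2, ((g : Matrix (Fin 2) (Fin 2) (FiniteAdeleRing (𝓞 K) K)) i j) v =
            (1 : Matrix (Fin 2) (Fin 2) (v.adicCompletion K)) i j) → g ∈ U) ∧
      IsHeckePoint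
        (Matrix.GeneralLinearGroup.map (algebraMap K (FiniteAdeleRing (𝓞 K) K)) :
          GL (Fin 2) K →* GL (Fin 2) (FiniteAdeleRing (𝓞 K) K))
        (LevelTower.ofSeq U (fun r : ℕ =>
          (principalCongruenceLevel 2 K (Ideal.span {((2 : ℕ) : 𝓞 K)} ^ r)).map (GLn.sndHom 2 K)))
        ((2 : ℕ) : (PadicAlgCl.valued 2).v.valuationSubring)
        (fun j : {v : HeightOneSpectrum (𝓞 K) // ∀ ℓ ∈ S₀, ((ℓ : ℕ) : 𝓞 K) ∉ v.asIdeal} × Fin 2 =>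
          GLn.sndHom 2 K (heckeDiagAt 2 K j.1.1 (ϖ j.1.1) (j.2.val + 1)))
        (fun j => a j.1 (j.2.val + 1)) := by
  sorry

/-! ### The composition -/

/-- COMPOSITION, with the automorphic-to-cohomology transport (A-raw) as an explicit hypothesis `hA`
(the registered signature of `stub_classicalHeckePoint`, verbatim): the crux `TwoAdicBianchiProModularityLevel`
follows from `hA`, the landed stubs and `stub_artinLift`.
`ϖ` from `stub_uniformizer`; `a_{v,1} := tr σ(Frob_v) / det σ(Frob_v)`,
`a_{v,2} := 1 / (q_v det σ(Frob_v))` read off the Frobenius polynomial `P_v` supplied by the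
residual-automorphy hypothesis, integral and Hansen-associated (`stub_heckeData`); the classical point
`(U₀, b)` of the big Hecke algebra from the cohomological `π₀` (`stub_classicalHeckePoint`), congruent
to `a` at every good place by the rank-two dictionary (`stub_congrDictionary`, applied at an arithmetic
Frobenius, which exists: `primesAbove_nonempty`, `exists_isArithFrobAt_of_mem_primesAbove_holds`);
`U` and the Hecke point of `a` from residual occurrence by big `R = 𝕋` (`stub_artinLift`). -/
theorem TwoAdicBianchiProModularityLevel_of_classicalPoint
    (hA : ∀ (K : Type) [Field K] [NumberField K], NumberField.IsTotallyComplex K →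
      Module.finrank ℚ K = 2 →
      ∀ (ι : PadicAlgCl 2 ≃+* ℂ) (hcpt : isCompact_glFiniteIntegralLevel 2 K)
        (π₀ : CuspidalAutomorphicRepData 2 K hcpt), π₀.1.IsRegularAlgebraic →
      ∀ S₀ : Finset ℕ, 2 ∈ S₀ →
      (∀ v : HeightOneSpectrum (𝓞 K), (∀ ℓ ∈ S₀, ((ℓ : ℕ) : 𝓞 K) ∉ v.asIdeal) → π₀.1.IsUnramifiedAt v) →
      ∃ U₀ : Subgroup (GL (Fin 2) (FiniteAdeleRing (𝓞 K) K)),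
        IsOpen (U₀ : Set (GL (Fin 2) (FiniteAdeleRing (𝓞 K) K))) ∧
        U₀ ≤ glFiniteIntegralLevel 2 K ∧
        (∀ g ∈ glFiniteIntegralLevel 2 K,
          (∀ v : HeightOneSpectrum (𝓞 K), ¬ (∀ ℓ ∈ S₀, ((ℓ : ℕ) : 𝓞 K) ∉ v.asIdeal) →
            ∀ i j : Fin 2, ((g : Matrix (Fin 2) (Fin 2) (FiniteAdeleRing (𝓞 K) K)) i j) v =
              (1 : Matrix (Fin 2) (Fin 2) (v.adicCompletion K)) i j) → g ∈ U₀) ∧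
        ∀ (ϖ : ∀ v : HeightOneSpectrum (𝓞 K), (v.adicCompletion K)ˣ),
          (∀ v : HeightOneSpectrum (𝓞 K),
            Valued.v ((ϖ v : (v.adicCompletion K)ˣ) : v.adicCompletion K) = WithZero.exp (-1 : ℤ)) →
          ∃ b : {v : HeightOneSpectrum (𝓞 K) // ∀ ℓ ∈ S₀, ((ℓ : ℕ) : 𝓞 K) ∉ v.asIdeal} → ℕ →
              (PadicAlgCl.valued 2).v.valuationSubring,
            (∀ (v : HeightOneSpectrum (𝓞 K)) (hv : ∀ ℓ ∈ S₀, ((ℓ : ℕ) : 𝓞 K) ∉ v.asIdeal)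
                (α : Multiset ℂ), π₀.1.HasSatakeParamAt v α →
              ι ((b ⟨v, hv⟩ 1 : (PadicAlgCl.valued 2).v.valuationSubring) : PadicAlgCl 2) =
                  (((Real.sqrt (v.residueCard : ℝ) : ℝ) : ℂ)) * α.esymm 1 ∧
              ι ((b ⟨v, hv⟩ 2 : (PadicAlgCl.valued 2).v.valuationSubring) : PadicAlgCl 2) =
                  α.esymm 2) ∧
            IsHeckePoint
              (Matrix.GeneralLinearGroup.map (algebraMap K (FiniteAdeleRing (𝓞 K) K)) :
                GL (Fin 2) K →* GL (Fin 2) (FiniteAdeleRing (𝓞 K) K))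
              (LevelTower.ofSeq U₀ (fun r : ℕ =>
                (principalCongruenceLevel 2 K (Ideal.span {((2 : ℕ) : 𝓞 K)} ^ r)).map (GLn.sndHom 2 K)))
              ((2 : ℕ) : (PadicAlgCl.valued 2).v.valuationSubring)
              (fun j : {v : HeightOneSpectrum (𝓞 K) // ∀ ℓ ∈ S₀, ((ℓ : ℕ) : 𝓞 K) ∉ v.asIdeal} × Fin 2 =>
                GLn.sndHom 2 K (heckeDiagAt 2 K j.1.1 (ϖ j.1.1) (j.2.val + 1)))
              (fun j => b j.1 (j.2.val + 1))) :
    Summit.Langlands.Langlands.Theses.ParityBlindBianchi.TwoAdicBianchiProModularityLevel := by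
  intro K _ _ htc hdeg hsplit ι σ hfin hirr hA5 S₀ h2 hres
  -- uniformisers
  choose ϖ hϖ using stub_uniformizer K
  obtain ⟨hcpt, π₀, hreg, hg⟩ := hres
  -- the Galois half: integral Hecke data associated with σ at the good places
  have hgood : ∀ v : HeightOneSpectrum (𝓞 K), (∀ ℓ ∈ S₀, ((ℓ : ℕ) : 𝓞 K) ∉ v.asIdeal) →
      σ.IsUnramifiedAt v ∧ ∃ P : Polynomial (PadicAlgCl 2), σ.HasFrobCharpolyAt v P := by
    intro v hv
    obtain ⟨α, P, -, hur, hPv, -⟩ := hg v hv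
    exact ⟨hur, P, hPv⟩
  obtain ⟨a, hassoc⟩ := stub_heckeData K σ hfin S₀ h2 hgood
  -- (A-raw) the classical point of the cohomological π₀
  have hunr : ∀ v : HeightOneSpectrum (𝓞 K), (∀ ℓ ∈ S₀, ((ℓ : ℕ) : 𝓞 K) ∉ v.asIdeal) →
      π₀.1.IsUnramifiedAt v := by
    intro v hv
    obtain ⟨α, P, hSat, -, -, -⟩ := hg v hv
    exact ⟨α, hSat⟩
  obtain ⟨U₀, hU₀o, hU₀le, hU₀3, hb⟩ :=
    hA K htc hdeg ι hcpt π₀ hreg S₀ h2 hunr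
  obtain ⟨b, hbval, hbpt⟩ := hb ϖ hϖ
  -- (A-glue) the classical point is congruent to the Hansen data of σ at every good place
  have hcongr : ∀ j : {v : HeightOneSpectrum (𝓞 K) // ∀ ℓ ∈ S₀, ((ℓ : ℕ) : 𝓞 K) ∉ v.asIdeal} × Fin 2,
      ‖((b j.1 (j.2.val + 1) : (PadicAlgCl.valued 2).v.valuationSubring) : PadicAlgCl 2) -
        ((a j.1 (j.2.val + 1) : (PadicAlgCl.valued 2).v.valuationSubring) : PadicAlgCl 2)‖ < 1 := by
    rintro ⟨⟨v, hv⟩, k⟩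
    obtain ⟨α, P, hSat, -, hPv, hcg⟩ := hg v hv
    -- an arithmetic Frobenius at v
    obtain ⟨𝔓, h𝔓⟩ := HeightOneSpectrum.primesAbove_nonempty v
    obtain ⟨g, hgF⟩ := HeightOneSpectrum.exists_isArithFrobAt_of_mem_primesAbove_holds (v := v) h𝔓
    set M : Matrix (Fin 2) (Fin 2) (PadicAlgCl 2) := ((σ g : GL (Fin 2) (PadicAlgCl 2)) :
      Matrix (Fin 2) (Fin 2) (PadicAlgCl 2)) with hM
    have hcp : M.charpoly = P := hPv 𝔓 h𝔓 g hgF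
    -- finite order
    obtain ⟨N, hN, hgN⟩ := exists_pow_eq_one_of_finite_range σ.toMonoidHom hfin g
    have hMN : M ^ N = 1 := by
      have := congrArg (fun u : GL (Fin 2) (PadicAlgCl 2) =>
        (u : Matrix (Fin 2) (Fin 2) (PadicAlgCl 2))) hgN
      simpa [hM, Units.val_pow_eq_pow_val] using this
    -- Hansen's normalisation of a: charpoly σ(g⁻¹) = X² − a₁ X + q a₂, and charpoly of the inverse
    have hinv : FramedRep.charpoly σ g⁻¹ = X ^ 2 - C (M.trace * M.det⁻¹) * X + C M.det⁻¹ := by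
      rw [FramedRep.charpoly, map_inv]
      exact stub_charpolyInv (PadicAlgCl 2) (σ g)
    have hass := (hassoc v hv).2 𝔓 h𝔓 g hgF
    rw [hinv, heckeFrobPoly_two _ _ (by simp)] at hass
    simp only [show (1 : ℕ) ≠ 0 by decide, show (2 : ℕ) ≠ 0 by decide, if_false] at hass
    have hq1 : ‖((v.residueCard : ℕ) : PadicAlgCl 2)‖ = 1 := stub_residueCardNorm K v (hv 2 h2)
    have hcg' : ∀ i : ℕ, ‖M.charpoly.coeff i - (arithFrobPolyOfSatake ι v.residueCard 2 α).coeff i‖ < 1 := by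
      rw [hcp]; exact hcg
    obtain ⟨h1, h2'⟩ := stub_congrDictionary ι v.residueCard hq1 M N hN hMN α hSat.card_eq hcg'
      _ _ _ _ hass (hbval v hv α hSat).1 (hbval v hv α hSat).2
    fin_cases k
    · exact h1
    · exact h2'
  -- (B) big R = 𝕋 at the Artin point: tame level and Hecke point of a
  obtain ⟨U, hUo, hUle, hU3, hpt⟩ :=
    stub_artinLift K htc hdeg hsplit σ hfin hirr hA5 S₀ h2 ϖ hϖ a hassoc
      ⟨U₀, hU₀o, hU₀le, hU₀3, b, hcongr, hbpt⟩
  exact ⟨U, ϖ, a, hUo, hUle, hU3, hϖ, hpt, hassoc⟩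


/-- COMPOSITION (registered form): the stubs imply the crux `TwoAdicBianchiProModularityLevel` by name —
`TwoAdicBianchiProModularityLevel_of_classicalPoint` fed with the registered stub `stub_classicalHeckePoint`
(open: closed only modulo the named fact) and, inside, `stub_artinLift` (open problem). -/
theorem TwoAdicBianchiProModularityLevel_of :
    Summit.Langlands.Langlands.Theses.ParityBlindBianchi.TwoAdicBianchiProModularityLevel :=
  TwoAdicBianchiProModularityLevel_of_classicalPoint stub_classicalHeckePoint

/-- COMPOSITION MODULO THE NAMED FACT (v4): the crux `TwoAdicBianchiProModularityLevel` follows from the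
Literature named fact `bianchi_regularAlgebraicCuspidal_isHeckePoint` (Eichler–Shimura–Harder + Scholze §V.4,
unproved in the tree, p106821) — through the LANDED conditional stub `stub_classicalHeckePoint_ofFact`
(p107234) — and the landed stubs; the ONLY `sorry` on this path is `stub_artinLift` (B: big `R = 𝕋` for
`GL₂/K`, `l₀ = 1`, `p = 2`, read at the Artin point — the open problem). -/
theorem TwoAdicBianchiProModularityLevel_of_fact
    (hX : Literature.NumberTheory.Automorphic.bianchi_regularAlgebraicCuspidal_isHeckePoint) :
    Summit.Langlands.Langlands.Theses.ParityBlindBianchi.TwoAdicBianchiProModularityLevel :=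
  -- = `TwoAdicBianchiProModularityLevel_of_classicalPoint (stub_classicalHeckePoint_ofFact hX)` with the landed
  -- conditional stub (p107234) inlined (its module is imported by the tree, not by this workfile).
  TwoAdicBianchiProModularityLevel_of_classicalPoint
    (fun K _ _ htc hdeg ι hcpt π₀ hreg S₀ h2 hur => hX K htc hdeg 2 ι hcpt π₀ hreg S₀ h2 hur)

/-- COMPOSITION MODULO THE TWO PRINTED THEOREMS BEHIND (A) (v5, lead c11): the crux
`TwoAdicBianchiProModularityLevel` follows from
* `hX : bianchi_cuspidal_regularLAlgebraic_eigenclassExists` — the Eichler–Shimura–Harder occurrence of a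
  regular algebraic cuspidal `π` of `GL₂` over an imaginary quadratic field in the cohomology of the Bianchi
  spaces [Harder1987], [Clozel1990, 3.14] (Literature named fact, unproved in the tree), and
* `hFL` — Borel–Serre as printed [BorelSerre1973, §11.1 (c), 11.6]: torsion-free arithmetic subgroups of
  `GL_n(K)` are of type `FL` (the explicit hypothesis of the tree's `…_of_typeFL_torsionFree` reductions),
through the Literature assembly `bianchi_regularAlgebraicCuspidal_isHeckePoint_of_eigenclassExists_of_typeFL`
(landed 2026-08-16, `RegularAlgebraicCuspidalHeckePointAssembly.lean`: fact (A) ⇐ ESH + FL, Scholze's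
Cor. V.4.2 assembled in Lean) and `TwoAdicBianchiProModularityLevel_of_fact`; the ONLY `sorry` on this path
is `stub_artinLift` (B).  So E2′ = {ESH, Borel–Serre FL} (theorems in print) + {B} (open problem), kernel-checked.
[cite: Scholze2015, §V.4, Cor. V.4.2] [cite: BorelSerre1973, §11.1 (c), 11.6] [cite: Harder1987] -/
theorem TwoAdicBianchiProModularityLevel_of_eigenclassExists_of_typeFL
    (hX : Literature.NumberTheory.Automorphic.bianchi_cuspidal_regularLAlgebraic_eigenclassExists)
    (hFL : ∀ (k : Type) [CommRing k] (n : ℕ) (K : Type) [Field K] [NumberField K]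
      (Γ : Subgroup (GL (Fin n) K)),
      Γ.Commensurable (Matrix.GeneralLinearGroup.map (algebraMap (𝓞 K) K) :
        GL (Fin n) (𝓞 K) →* GL (Fin n) K).range →
      (∀ g : Γ, IsOfFinOrder g → g = 1) →
      ∃ P : CategoryTheory.ProjectiveResolution (Rep.trivial k Γ k),
        ∀ i, ∃ m : ℕ, Nonempty (P.complex.X i ≅ Rep.free k Γ (Fin m))) :
    Summit.Langlands.Langlands.Theses.ParityBlindBianchi.TwoAdicBianchiProModularityLevel :=
  TwoAdicBianchiProModularityLevel_of_fact
    (Literature.NumberTheory.Automorphic.bianchi_regularAlgebraicCuspidal_isHeckePoint_of_eigenclassExists_of_typeFL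
      hX hFL)

end Summit.Langlands.Langlands.Theorems.TwoAdicBianchiProModularityLevel

end
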